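import Summits.CriticalPhenomena.PercolationContinuityZ3.Theorems.PercNearOneGluingNoHeavyLowerTailFourCopyHubCheck
import HarnessLib

/-! — part 1: bounds, table lookups, fibres in specification form, list lemmas
# `NoHeavyLowerTail` (stmt-CriticalPhenomena-4575) — FOUR-copy switching certificates, IV: SOUNDNESS of the hub checker —
# the real value of a certificate is bounded by the kernel's row value at the real hub state

Support file (prover prim-ineq-prove-3 gen 8; `--supports stmt-CriticalPhenomena-4575`).  No named facts, no sorries.

For a well-formed bounded certificate `c` (`Cert.ok`), a finite graph, a placement `τ` of the four terminals and a
four-tuple `x` of configurations with types `πX, t₁, t₂, t₃` and real projected hub state `s₃`: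
`Sreal c τ x ≤ candT c πX t₁ t₂ t₃ s₃` (`Sreal_le_candT`).  Steps: (1) every program's value is at most the best value
over the admissible output classes at the real avoidance options (parts I–II); (2) regrouping the programs by
(side copy, block of the side root); (3) the stored tables of part III encode these best values with the offset `OFF`,
sums of packed vectors are read digitwise (part III-a), and the kernel's maximum over the option positions dominates the
digit at the real option.  With `piCheck` (every row entry `≤ B`) this gives `Sreal ≤ B(types)` (`Sreal_le_of_piCheck`).
-/

noncomputable section

namespace Summit.CriticalPhenomena.PercolationContinuityZ3.Theorems

namespace FourCopyHub

open Finset Literature.Probability.Percolation Literature.Probability.Percolation.DecisionTree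
open Literature.Probability.Percolation.Gladkov ThreePointLB GroupThreePointLB FourPointAtoms SwitchRelax
open scoped Classical

/-! ### Certificate-level bounds -/

/-- All class indices are `< ncls`, all coarse class indices are `< ncl2`, all potential entries on the index ranges
are `< OFF`, and there are fewer than `1024` programs. [this work] -/
def Cert.bounded (c : Cert) : Bool :=
  allTys.all (fun t => decide (c.cls t < c.ncls)) &&
  allTys.all (fun t => decide (c.cls2 t < c.ncl2)) &&
  c.one.all (fun q => (List.range c.ncls).all fun o => (List.range (if q.T = 3 then c.ncls else c.ncl2)).all fun a =>
    (List.range c.ncls).all fun b => decide (q.lam o a b < OFF)) &&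
  c.two.all (fun q => (List.range c.ncls).all fun a => (List.range c.ncls).all fun b =>
    (List.range c.ncl2).all fun i => decide (q.lam a b i < OFF)) &&
  decide (c.one.length + c.two.length < 1024)

/-- A usable certificate: well formed and bounded. [this work] -/
def Cert.ok (c : Cert) : Bool := c.wf && c.bounded

section Bounds

variable {c : Cert} (hc : c.bounded = true)
include hc

/-- Auxiliary lemma `cls_lt` (see the statement). [this work] -/
theorem cls_lt (t : Ty) : c.cls t < c.ncls := by
  have h := hc; simp only [Cert.bounded, Bool.and_eq_true, List.all_eq_true, decide_eq_true_iff] at h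
  exact h.1.1.1.1 t (mem_allTys t)

/-- Auxiliary lemma `cls2_lt` (see the statement). [this work] -/
theorem cls2_lt (t : Ty) : c.cls2 t < c.ncl2 := by
  have h := hc; simp only [Cert.bounded, Bool.and_eq_true, List.all_eq_true, decide_eq_true_iff] at h
  exact h.1.1.1.2 t (mem_allTys t)

/-- The index range of the first idle argument of a one-step program. [this work] -/
def P1.na (c : Cert) (q : P1) : ℕ := if q.T = 3 then c.ncls else c.ncl2

/-- Auxiliary lemma `lam1_lt` (see the statement). [this work] -/
theorem lam1_lt {q : P1} (hq : q ∈ c.one) (t : Ty) {a b : ℕ} (ha : a < q.na c) (hb : b < c.ncls) :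
    q.lam (c.cls t) a b < OFF := by
  have h := hc; simp only [Cert.bounded, Bool.and_eq_true, List.all_eq_true, decide_eq_true_iff] at h
  exact h.1.1.2 q hq _ (List.mem_range.2 (cls_lt hc t)) _ (List.mem_range.2 ha) _ (List.mem_range.2 hb)

/-- Auxiliary lemma `lam2_lt` (see the statement). [this work] -/
theorem lam2_lt {q : P2} (hq : q ∈ c.two) (s t : Ty) {i : ℕ} (hi : i < c.ncl2) : q.lam (c.cls s) (c.cls t) i < OFF := by
  have h := hc; simp only [Cert.bounded, Bool.and_eq_true, List.all_eq_true, decide_eq_true_iff] at h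
  exact h.1.2 q hq _ (List.mem_range.2 (cls_lt hc s)) _ (List.mem_range.2 (cls_lt hc t)) _ (List.mem_range.2 hi)

/-- Auxiliary lemma `size_lt` (see the statement). [this work] -/
theorem size_lt : c.one.length + c.two.length < 1024 := by
  have h := hc; simp only [Cert.bounded, Bool.and_eq_true, List.all_eq_true, decide_eq_true_iff] at h
  exact h.2

/-- `e1` is below `OFF`. [this work] -/
theorem e1_lt {q : P1} (hq : q ∈ c.one) (πX p : Ty) {a b : ℕ} (ha : a < q.na c) (hb : b < c.ncls) :
    e1 c πX q p a b < OFF := by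
  refine lmax_lt (by decide) fun z hz => ?_
  rw [List.mem_map] at hz
  obtain ⟨o, ho, rfl⟩ := hz
  rw [cleanC, List.mem_dedup, List.mem_map] at ho
  obtain ⟨t, _, rfl⟩ := ho
  exact lam1_lt hc hq t ha hb

/-- `e2` is below `OFF`. [this work] -/
theorem e2_lt {q : P2} (hq : q ∈ c.two) (πX p₁ t₂ p₂ : Ty) {i : ℕ} (hi : i < c.ncl2) : e2 c πX q p₁ t₂ p₂ i < OFF := by
  refine lmax_lt (by decide) fun z hz => ?_
  rw [List.mem_flatMap] at hz
  obtain ⟨cf, hcf, hz⟩ := hz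
  rw [List.mem_map] at hz
  obtain ⟨cs, hcs, rfl⟩ := hz
  rw [cleanC, List.mem_dedup, List.mem_map] at hcf
  rw [messyC, List.mem_dedup, List.mem_map] at hcs
  obtain ⟨o, _, rfl⟩ := hcf
  obtain ⟨o', _, rfl⟩ := hcs
  exact lam2_lt hc hq o o' hi

/-- `e2g` is below `OFF`. [this work] -/
theorem e2g_lt {q : P2} (hq : q ∈ c.two) (πX p₁ t₂ p₂ : Ty) {i : ℕ} (hi : i < c.ncl2) : e2g c πX q p₁ t₂ p₂ i < OFF := by
  unfold e2g; split_ifs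
  · exact e2_lt hc hq πX p₁ t₂ p₂ hi
  · decide

end Bounds

/-! ### Table lookups -/

section Tables

variable (c : Cert) (πX : Ty)

/-- Auxiliary lemma `RBtab_lk` (see the statement). [this work] -/
theorem RBtab_lk (u : Fin 4) (p : Ty) : lk (lk (RBtab πX) u.val []) p.val false = relB πX u p := by
  simp only [RBtab, lk_map_finRange4, lk_map_allTys]

/-- Auxiliary lemma `CTab_lk` (see the statement). [this work] -/
theorem CTab_lk (u : Fin 4) (p : Ty) : lk (lk (CTab c πX) u.val []) p.val [] = cleanC c πX u p := by
  simp only [CTab, lk_map_finRange4, lk_map_allTys]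

/-- Auxiliary lemma `MTab_lk` (see the statement). [this work] -/
theorem MTab_lk (u v : Fin 4) (t p : Ty) (hp : relB πX v p = true) :
    lk (lk (lk (lk (MTab c πX) u.val []) v.val []) t.val []) p.val [] = messyC c πX u v t p := by
  simp only [MTab, lk_map_finRange4, lk_map_allTys, hp, if_true]

/-- Auxiliary lemma `clean_eq` (see the statement). [this work] -/
theorem clean_eq (u : Fin 4) (p : Ty) : (mkPiTabs c πX).clean u p = cleanC c πX u p := CTab_lk c πX u p

/-- Auxiliary lemma `relv_eq` (see the statement). [this work] -/
theorem relv_eq (u : Fin 4) (p : Ty) : (mkPiTabs c πX).relv u p = relB πX u p := RBtab_lk πX u p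

/-- Auxiliary lemma `messy_eq` (see the statement). [this work] -/
theorem messy_eq (u v : Fin 4) (t p : Ty) (hp : relB πX v p = true) :
    (mkPiTabs c πX).messy u v t p = messyC c πX u v t p := MTab_lk c πX u v t p hp

/-- Auxiliary lemma `opts_eq` (see the statement). [this work] -/
theorem opts_eq (t : Ty) (w : Fin 4) : (mkPiTabs c πX).opts t w = optsF πX t w := by
  simp only [PiTabs.opts, mkPiTabs, lk_map_allTys, lk_map_finRange4]

/-- Reading a map over `List.range`. [folklore] -/
theorem lk_map_range {β : Type} (n : ℕ) (f : ℕ → β) {i : ℕ} (hi : i < n) (d : β) :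
    lk ((List.range n).map f) i d = f i := by
  simp only [lk, List.getElem?_map, List.getElem?_range hi]; rfl

/-- The hub one-step table at the index of a class pair. [this work] -/
theorem x1hub_lk (q : P1) {a b : ℕ} (ha : a < c.ncls) (hb : b < c.ncls) :
    lk (x1hub (CTab c πX) c.ncls q) (c.ncls * a + b) 0 = pvec fun p => e1 c πX q p a b := by
  have hn : 0 < c.ncls := by omega
  have hi : c.ncls * a + b < c.ncls * c.ncls := by nlinarith
  rw [x1hub, lk_map_range _ _ hi, Nat.mul_add_div hn, Nat.mul_add_mod, Nat.div_eq_of_lt hb, Nat.mod_eq_of_lt hb,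
    Nat.add_zero]
  refine congrArg pvec (funext fun p => ?_)
  rw [CTab_lk]; rfl

/-- The side one-step table at a coarse class. [this work] -/
theorem x1side_lk (q : P1) (b : ℕ) {a : ℕ} (ha : a < c.ncl2) :
    lk (x1side (CTab c πX) c.ncl2 b q) a 0 = pvec fun p => e1 c πX q p a b := by
  rw [x1side, lk_map_range _ _ ha]
  refine congrArg pvec (funext fun p => ?_)
  rw [CTab_lk]; rfl

/-- Inner entries of the hub-first table. [this work] -/
theorem xhf_inner_eq (q : P2) (pu tT p : Ty) (a : ℕ) (hu : relB πX q.u pu = true) :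
    (if lk (lk (RBtab πX) q.v.val []) p.val false then
        e2T (fun cf cs => q.lam cf cs a) (lk (lk (CTab c πX) q.u.val []) pu.val [])
          (lk (lk (lk (lk (MTab c πX) q.u.val []) q.v.val []) tT.val []) p.val [])
      else bot) = e2g c πX q pu tT p a := by
  rw [RBtab_lk, e2g, hu, Bool.true_and]
  by_cases hv : relB πX q.v p = true
  · rw [if_pos hv, if_pos hv, CTab_lk, MTab_lk c πX _ _ _ _ hv]; rfl
  · rw [if_neg hv, if_neg hv]

/-- The hub-first table in specification form. [this work] -/
theorem xhfOf_eq (q : P2) (h : q.T1 = 3) : xhfOf (CTab c πX) (MTab c πX) (RBtab πX) c.ncl2 q = xhfT c πX q := by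
  rw [xhfT, if_pos h, xhfOf]
  refine List.map_congr_left fun a _ => List.map_congr_left fun pu _ => ?_
  rw [RBtab_lk]
  by_cases hu : relB πX q.u pu = true
  · rw [if_pos hu, if_pos hu]
    exact congrArg (packL BV) (List.map_congr_left fun tT _ =>
      congrArg pvec (funext fun p => xhf_inner_eq c πX q pu tT p a hu))
  · rw [if_neg hu, if_neg hu]

/-- Auxiliary lemma `P1s_eq` (see the statement). [this work] -/
theorem P1s_eq : (mkPiTabs c πX).P1s = c.one.map fun q => (q, rep πX q.u) := rfl

/-- Auxiliary lemma `CT_eq` (see the statement). [this work] -/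
theorem CT_eq : (mkPiTabs c πX).CT = CTab c πX := rfl

/-- Auxiliary lemma `P2s_eq` (see the statement). [this work] -/
theorem P2s_eq : (mkPiTabs c πX).P2s = c.two.map fun q => (q, xhfT c πX q, rep πX q.u, rep πX q.v) := by
  show (c.two.map fun q => (q, (if q.T1 = 3 then xhfOf (CTab c πX) (MTab c πX) (RBtab πX) c.ncl2 q else []),
    rep πX q.u, rep πX q.v)) = _
  refine List.map_congr_left fun q _ => ?_
  by_cases h : q.T1 = 3
  · rw [if_pos h, xhfOf_eq c πX q h]
  · rw [if_neg h, xhfT, if_neg h]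

/-! ### Fibres in specification form -/

/-- One-step programs of fibre `(T, w)`. [this work] -/
def onef (T w : Fin 4) : List P1 := c.one.filter fun q => q.T = T ∧ rep πX q.u = w
/-- Side-first programs of fibre `(T, w)`. [this work] -/
def sff (T w : Fin 4) : List P2 := c.two.filter fun q => q.T2 = 3 ∧ q.T1 = T ∧ rep πX q.u = w
/-- Hub-first programs of fibre `(T, w)`. [this work] -/
def hff (T w : Fin 4) : List P2 := c.two.filter fun q => q.T1 = 3 ∧ q.T2 = T ∧ rep πX q.v = w

/-- Auxiliary lemma `F_one_eq` (see the statement). [this work] -/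
theorem F_one_eq (t3 : Ty) (T w : Fin 4) :
    (mkFib c (mkPiTabs c πX) t3 T w).one = (onef c πX T w).map fun q => x1side (CTab c πX) c.ncl2 (c.cls t3) q := by
  simp only [mkFib, P1s_eq, CT_eq, List.filter_map, List.map_map]; rfl

/-- Auxiliary lemma `F_sf_eq` (see the statement). [this work] -/
theorem F_sf_eq (t3 : Ty) (T w : Fin 4) :
    (mkFib c (mkPiTabs c πX) t3 T w).sf = (sff c πX T w).map fun q => (xsfOf (mkPiTabs c πX) c.ncl2 t3 q, rep πX q.v) := by
  simp only [mkFib, P2s_eq, List.filter_map, List.map_map]; rfl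

/-- Auxiliary lemma `F_hf_eq` (see the statement). [this work] -/
theorem F_hf_eq (t3 : Ty) (T w : Fin 4) :
    (mkFib c (mkPiTabs c πX) t3 T w).hf = (hff c πX T w).map fun q => (xhfT c πX q, rep πX q.u) := by
  simp only [mkFib, P2s_eq, List.filter_map, List.map_map]; rfl

/-- The side-first table read at a coarse class and a relevant hub option. [this work] -/
theorem xsf_lk (t3 : Ty) (q : P2) {a : ℕ} (ha : a < c.ncl2) (pv : Ty) (hv : relB πX q.v pv = true) :
    lk (lk (xsfOf (mkPiTabs c πX) c.ncl2 t3 q) a []) pv.val 0 = pvec fun p => e2g c πX q p t3 pv a := by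
  rw [xsfOf, lk_map_range _ _ ha, lk_map_allTys, relv_eq, if_pos hv]
  refine congrArg pvec (funext fun p => ?_)
  rw [relv_eq, e2g, hv, Bool.and_true]
  by_cases hu : relB πX q.u p = true
  · rw [if_pos hu, if_pos hu, clean_eq, messy_eq c πX _ _ _ _ hv, e2]
  · rw [if_neg hu, if_neg hu]

/-- The hub-first table read at a coarse class and a relevant hub option. [this work] -/
theorem xhf_lk (q : P2) (h3 : q.T1 = 3) {a : ℕ} (ha : a < c.ncl2) (pu : Ty) (hu : relB πX q.u pu = true) :
    lk (lk (xhfT c πX q) a []) pu.val 0 = packL BV (allTys.map fun tT => pvec fun p => e2g c πX q pu tT p a) := by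
  rw [xhfT, if_pos h3, lk_map_range _ _ ha, lk_map_allTys, if_pos hu]

/-- `zip` of a list with its own map. [folklore] -/
theorem zip_map_self {α β : Type} (l : List α) (g : α → β) : l.zip (l.map g) = l.map fun a => (a, g a) := by
  induction l with
  | nil => rfl
  | cons a l ih => simp [ih]

/-- Reading the columns of a fibre at a coarse class and a side base type. [this work] -/
theorem lk_col (F : Fib) (n2 : ℕ) (g : Ty → List ℕ) (s3 : St4) {a : ℕ} (ha : a < n2) (tT : Ty) :
    lk (lk (F.col n2 (allTys.map g) s3) a []) tT.val 0 =
      nmax ((g tT).map fun p => digW ((F.one.map fun e => lk e a 0).sum + (F.sf.map fun e => lk (lk e.1 a []) (s3 e.2).val 0).sum +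
        digV ((F.hf.map fun e => lk (lk e.1 a []) (s3 e.2).val 0).sum) tT.val) p) := by
  rw [Fib.col, lk_map_range _ _ ha]
  simp only [zip_map_self, List.map_map, Function.comp_def, lk_map_allTys]

/-- Outer length of the columns. [this work] -/
theorem length_col (F : Fib) (n2 : ℕ) (OPw : List (List ℕ)) (s3 : St4) : (F.col n2 OPw s3).length = n2 := by
  rw [Fib.col, List.length_map, List.length_range]

/-- Inner length of the columns. [this work] -/
theorem length_of_mem_col (F : Fib) (n2 : ℕ) (g : Ty → List ℕ) (s3 : St4) {col : List ℕ}
    (h : col ∈ F.col n2 (allTys.map g) s3) : col.length = 15 := by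
  rw [Fib.col, List.mem_map] at h
  obtain ⟨a, _, rfl⟩ := h
  simp only [zip_map_self, List.map_map, List.length_map]; rfl

/-- Reading a mapped list inside its range. [folklore] -/
theorem lk_map_of_lt {α β : Type} (L : List α) (f : α → β) (i : ℕ) (hi : i < L.length) (d : β) (d' : α) :
    lk (L.map f) i d = f (lk L i d') := by
  simp only [lk, List.getElem?_map, List.getElem?_eq_getElem hi]; rfl

/-- A lookup inside the range is a member. [folklore] -/
theorem lk_mem_of_lt {α : Type} (L : List α) {i : ℕ} (hi : i < L.length) (d : α) : lk L i d ∈ L := by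
  simp only [lk, List.getElem?_eq_getElem hi]; exact List.getElem_mem hi

end Tables

/-! ### List lemmas for regrouping -/

section Lists

variable {α : Type}

/-- Splitting a sum along a decidable predicate. [folklore] -/
theorem sum_filter_split (L : List α) (f : α → ℤ) (P : α → Prop) [DecidablePred P] :
    (L.map f).sum = ((L.filter fun a => P a).map f).sum + ((L.filter fun a => ¬P a).map f).sum := by
  induction L with
  | nil => simp
  | cons a L ih =>
    by_cases h : P a
    · simp [h, ih]; ring
    · simp [h, ih]; ring

/-- Splitting a sum along a key with four values. [folklore] -/
theorem sum_key4 (L : List α) (key : α → Fin 4) (f : α → ℤ) :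
    (L.map f).sum = ((L.filter fun a => key a = 0).map f).sum + ((L.filter fun a => key a = 1).map f).sum +
      ((L.filter fun a => key a = 2).map f).sum + ((L.filter fun a => key a = 3).map f).sum := by
  induction L with
  | nil => simp
  | cons a L ih =>
    simp only [List.map_cons, List.sum_cons, List.filter_cons, ih]
    have hk : key a = 0 ∨ key a = 1 ∨ key a = 2 ∨ key a = 3 := by
      rcases key a with ⟨k, hk⟩; interval_cases k <;> simp
    rcases hk with h | h | h | h <;> simp [h] <;> ring

/-- `filter` of a conjunction. [folklore] -/
theorem filter_and (L : List α) (P Q : α → Prop) [DecidablePred P] [DecidablePred Q] :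
    (L.filter fun a => P a ∧ Q a) = (L.filter fun a => P a).filter fun a => Q a := by
  rw [List.filter_filter]
  exact List.filter_congr fun a _ => by by_cases hP : P a <;> by_cases hQ : Q a <;> simp [hP, hQ]

/-- A filter whose predicate fails everywhere is empty, so its sum vanishes. [folklore] -/
theorem sum_filter_eq_zero (L : List α) (f : α → ℤ) (P : α → Prop) [DecidablePred P] (h : ∀ a ∈ L, ¬P a) :
    ((L.filter fun a => P a).map f).sum = 0 := by
  rw [List.filter_eq_nil_iff.2 fun a ha => by simpa using h a ha]; rfl

/-- `zipWith` of two maps of one list. [folklore] -/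
theorem zipWith_map_map {β γ δ : Type} (l : List α) (g : α → β) (h : α → γ) (f : β → γ → δ) :
    List.zipWith f (l.map g) (l.map h) = l.map fun a => f (g a) (h a) := by
  induction l with
  | nil => rfl
  | cons a l ih => simp [ih]

/-- Lookup defaults do not matter inside the range. [folklore] -/
theorem lk_eq_lk_of_lt {L : List ℤ} {i : ℕ} (hi : i < L.length) (d d' : ℤ) : lk L i d = lk L i d' := by
  simp only [lk, List.getElem?_eq_getElem hi]; rfl

/-- Shape of a table: `m` rows of length `15`. [this work] -/
def Shp (m : ℕ) (L : List (List ℤ)) : Prop := L.length = m ∧ ∀ r ∈ L, r.length = 15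

/-- The zero table has the shape. [this work] -/
theorem shp_replicate (m : ℕ) : Shp m (List.replicate m (List.replicate 15 (0 : ℤ))) :=
  ⟨List.length_replicate, fun r hr => by rw [(List.mem_replicate.1 hr).2, List.length_replicate]⟩

/-- An elementwise sum of tables of a shape has the shape. [this work] -/
theorem shp_zipWith {m : ℕ} {A B : List (List ℤ)} (hA : Shp m A) (hB : Shp m B) :
    Shp m (List.zipWith (fun r1 a1 => List.zipWith (· + ·) r1 a1) A B) := by
  refine ⟨by rw [List.length_zipWith, hA.1, hB.1, min_self], fun r hr => ?_⟩
  obtain ⟨i, hi, rfl⟩ := List.getElem_of_mem hr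
  rw [List.length_zipWith] at hi
  rw [List.getElem_zipWith, List.length_zipWith, hA.2 _ (List.getElem_mem _), hB.2 _ (List.getElem_mem _), min_self]

/-- An iterated elementwise sum of tables of a shape has the shape. [this work] -/
theorem shp_foldr (m : ℕ) (Ls : List (List (List ℤ))) (h : ∀ L ∈ Ls, Shp m L) :
    Shp m (Ls.foldr (fun r acc => List.zipWith (fun r1 a1 => List.zipWith (· + ·) r1 a1) r acc)
      (List.replicate m (List.replicate 15 0))) := by
  induction Ls with
  | nil => exact shp_replicate m
  | cons L Ls ih =>
    rw [List.foldr_cons]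
    exact shp_zipWith (h L List.mem_cons_self) (ih fun L' hL' => h L' (List.mem_cons_of_mem _ hL'))

/-- Reading an iterated elementwise sum of tables. [this work] -/
theorem lk_foldr_zipWith2 (m : ℕ) (Ls : List (List (List ℤ))) (h : ∀ L ∈ Ls, Shp m L) {a : ℕ} (ha : a < m)
    {i : ℕ} (hi : i < 15) :
    lk (lk (Ls.foldr (fun r acc => List.zipWith (fun r1 a1 => List.zipWith (· + ·) r1 a1) r acc)
      (List.replicate m (List.replicate 15 0))) a []) i 0 = (Ls.map fun L => lk (lk L a []) i 0).sum := by
  induction Ls with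
  | nil =>
    simp only [List.foldr_nil, List.map_nil, List.sum_nil, lk, List.getElem?_replicate, ha, if_true, Option.getD_some,
      hi]
  | cons L Ls ih =>
    have hL : Shp m L := h L List.mem_cons_self
    have hLs : ∀ L' ∈ Ls, Shp m L' := fun L' hL' => h L' (List.mem_cons_of_mem _ hL')
    have hF := shp_foldr m Ls hLs
    simp only [List.foldr_cons, List.map_cons, List.sum_cons]
    rw [← ih hLs]
    set F := Ls.foldr (fun r acc => List.zipWith (fun r1 a1 => List.zipWith (· + ·) r1 a1) r acc)
      (List.replicate m (List.replicate 15 0)) with hFdef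
    have haL : a < L.length := by rw [hL.1]; exact ha
    have haF : a < F.length := by rw [hF.1]; exact ha
    have hiL : i < (L[a]'haL).length := by rw [hL.2 _ (List.getElem_mem _)]; exact hi
    have hiF : i < (F[a]'haF).length := by rw [hF.2 _ (List.getElem_mem _)]; exact hi
    simp only [lk, List.getElem?_zipWith, List.getElem?_eq_getElem haL, List.getElem?_eq_getElem haF,
      Option.getD_some, List.getElem?_eq_getElem hiL, List.getElem?_eq_getElem hiF]

end Lists

end FourCopyHub

end Summit.CriticalPhenomena.PercolationContinuityZ3.Theorems

end
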